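/-
Copyright (c) 2026 the pub-hodgecm-mathlib formalisation cell (harness21).  Prover seat hodgecm-mathlib-LH4-p13 (g8), req620 Track A «(D-RAM) FOUR-FRAME» squad, tier 0,
STAGE-1b (dealer LH4-plan (g13) WORD #66 (3); LH4-p05 (g8) ★ p859970 №7 `CleanLabelDichotomyLawAt` (A″), producer LH4-p13): brick (L-lab-17a) «THE S-GRAM OF THE HNF BASIS
AND THE TWO GRAM–SCHMIDT TRIPLES» — the algebra half of the label-free lattice statement (GS) of ★ (L-lab-16) on the ★ HNF model of LH4-p10∕p12∕p09
(`latt [[1,0,0],[x,ϖ^b,0],[y,z,ϖ^c]]` with its polarisation `diag D`).  2026-09-04.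
-/
import Summits.HodgeConjecture.HodgeConjecture.Theorems.F0P3cDyRamModelSquareLevelClean   -- ★ p859653 (this seat, (L-lab-14)): `pairing_diagonal_three`, `smul_diagonal_mulVec_apply`; brings ★ p859056
                                                                                          -- `latticeInLevel_iff_forall_smul_mulVec_mem`, `latticeInLevel_diagonal_latt_hnf_iff`, ★ `mulVec_hnf`, ★ Literature lattice API, ★ `v_pow_eq_exp_neg`
import Summits.HodgeConjecture.HodgeConjecture.Theorems.F0P3cDyRamDiagonalDualisableStrata  -- ★ B3 (LH4-p10 (g2)): `dualisable_strata`; brings ★ `dualFrame_values`, `gram_values`, ★ DEFS `IsNormalisedLattice`, `IsDualisableLattice`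
import HarnessLib

/-!
# Crux `H413`, line LH4 «(D-RAM) FOUR-FRAME», STAGE-1b — (L-lab-17a) «THE S-GRAM OF THE HNF BASIS AND THE TWO GRAM–SCHMIDT TRIPLES»

Cell `hodgecm-mathlib` (D-0151), FLOOR 0, crux item H413 = `stmt-HodgeConjecture-24833`, route of record `HCCMUnconditional`; squad F0∕P3c∕LH4.  THEOREMS ONLY (no `def`, no
instance, no notation, no `sorry`, default heartbeats), ★-only imports, lane `--supports stmt-HodgeConjecture-24833`.

THE MATHEMATICS.  Normalised HNF lattice `L = V·𝒪³`, `V = [[1,0,0],[x,ϖ^b,0],[y,z,ϖ^c]]` (`x y z ∈ 𝒪`), self-dual for a `σ`-fixed non-degenerate `diag D`; `T = diag(α, β, 1)`,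
`α, β ∈ E¹`, `X = diag(α−1, β−1, 0)`; `S(w, w′) = D₀σ(w₀)(α−1)w′₀ + D₁σ(w₁)(β−1)w′₁ = ⟨w, Xw′⟩_D`.  Columns `v⁰ = (1,x,y)`, `v¹ = (0,ϖ^b,z)`, `v² = (0,0,ϖ^c)`; S-Gram entries
`A = S(v⁰,v⁰)`, `B = S(v⁰,v¹)`, `B′ = S(v¹,v⁰)`, `C = S(v¹,v¹)` (the `v²` row and column vanish).
* §1 `cross_latt_hnf_expand` (`S(Vp, Vq) = σp₀q₀A + σp₀q₁B + σp₁q₀B′ + σp₁q₁C`); `v_cross_le_of_latticeInLevel_of_integral` (`|S| ≤ |ϖ^ℓ|` on `L × L` at level `ℓ`);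
  `exists_gram_gt_of_not_latticeInLevel` (self-dual `L` NOT at level `ℓ+1` ⇒ one of `A, B, B′, C` exceeds `|ϖ^{ℓ+1}|`); `eq_of_le_of_gt_succ` (discreteness).
* §2 the two Gram–Schmidt triples: `triple_A` (`A` on top: `(v⁰, v¹ − (B∕A)v⁰, v²)`, second value `(AC − BB′)∕A = D₀D₁(α−1)(β−1)N(ϖ^b)∕A`), `triple_C` (`C` on top, `b = 0`:
  `(v¹, v⁰ − (B′∕C)v¹, v²)`, second value `D₀(α−1)`).
* The level arithmetic (LEMMA Q, the exclusion of a lone cross entry on top) and the HEAD «(GS) on the clean shell» are the sequel (L-lab-17b) `F0P3cDyRamHNFDiagonalTriple`.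

HONEST LABEL: count-neutral; these are the (A″) engines on the HNF model; the transport to `CleanLabelDichotomyLawAt` (★ №7) is (L-lab-18).  HC_CM remains proved only modulo the printed
citations (2 remaining named inputs: hLiu418 = `stmt-HodgeConjecture-24832`, h413 = `stmt-HodgeConjecture-24833`) until rung 0 closes.
-/

noncomputable section

namespace Summit.HodgeConjecture.HodgeConjecture.Cruxes.H413.F0P3cDyRamHNFCrossGram

open Literature.NumberTheory.Automorphic Literature.NumberTheory.Automorphic.HermitianLattice Literature.NumberTheory.Automorphic.UnitaryGroup
open Literature.NumberTheory.Automorphic.UnitaryLatticeTree Literature.NumberTheory.Automorphic.UnitaryThreeFourFrame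
open Summit.HodgeConjecture.HodgeConjecture.Cruxes.H413.F0P3cDyRamFourFramePieces
open Summit.HodgeConjecture.HodgeConjecture.Cruxes.H413.F0P3cDyRamFourFrameCensusDefs
open Summit.HodgeConjecture.HodgeConjecture.Cruxes.H413.F0P3cDyRamDiagonalTorusDefs
open Summit.HodgeConjecture.HodgeConjecture.Cruxes.H413.F0P3cDyRamDiagonalStableLatticeHNF
open Summit.HodgeConjecture.HodgeConjecture.Cruxes.H413.F0P3cDyRamDiagonalHNFDualFrameValues (dualFrame_values gram_values)
open Summit.HodgeConjecture.HodgeConjecture.Cruxes.H413.F0P3cDyRamDiagonalDualisableStrata (dualisable_strata)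
open Summit.HodgeConjecture.HodgeConjecture.Cruxes.H413.F0P3cDyRamLevelTokenHNF (latticeInLevel_iff_forall_smul_mulVec_mem latticeInLevel_diagonal_latt_hnf_iff)
open Summit.HodgeConjecture.HodgeConjecture.Cruxes.H413.F0P3cDyRamUniformizerPowerTube (v_pow_eq_exp_neg)
open Summit.HodgeConjecture.HodgeConjecture.Cruxes.H413.F0P3cDyRamModelSquareLevelClean (pairing_diagonal_three smul_diagonal_mulVec_apply)
open scoped Valued WithZero Matrix MatrixGroups
open WithZero

variable {K : Type} [Field K] [Valued K ℤᵐ⁰]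

/-! ## §1  The S-Gram of the HNF basis; one entry sits on the level -/

omit [Valued K ℤᵐ⁰] in
/-- **THE S-GRAM EXPANSION ON THE HNF BASIS.**  For `w = V·p`, `w′ = V·q`:
`S(w, w′) = σp₀·q₀·A + σp₀·q₁·B + σp₁·q₀·B′ + σp₁·q₁·C` with `A = D₀(α−1) + D₁σx(β−1)x`, `B = D₁σx(β−1)ϖ^b`, `B′ = D₁σ(ϖ^b)(β−1)x`, `C = D₁σ(ϖ^b)(β−1)ϖ^b`
(the `v²`-coordinates do not enter: `X` kills the third axis). [cite: Jacobowitz1962, §4] [cite: Serre1980Trees, Ch. II §1.1] -/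
theorem cross_latt_hnf_expand (σ : K →+* K) (D : Fin 3 → K) (α β x y z pb pc : K) (p q : Fin 3 → K) :
    D 0 * σ (((Matrix.of ![![1, 0, 0], ![x, pb, 0], ![y, z, pc]]) *ᵥ p) 0) * ((α - 1) * ((Matrix.of ![![1, 0, 0], ![x, pb, 0], ![y, z, pc]]) *ᵥ q) 0) +
        D 1 * σ (((Matrix.of ![![1, 0, 0], ![x, pb, 0], ![y, z, pc]]) *ᵥ p) 1) * ((β - 1) * ((Matrix.of ![![1, 0, 0], ![x, pb, 0], ![y, z, pc]]) *ᵥ q) 1) =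
      σ (p 0) * q 0 * (D 0 * (α - 1) + D 1 * σ x * ((β - 1) * x)) + σ (p 0) * q 1 * (D 1 * σ x * ((β - 1) * pb)) +
        σ (p 1) * q 0 * (D 1 * σ pb * ((β - 1) * x)) + σ (p 1) * q 1 * (D 1 * σ pb * ((β - 1) * pb)) := by
  rw [mulVec_hnf, mulVec_hnf]
  simp only [Matrix.cons_val_zero, Matrix.cons_val_one, map_add, map_mul]
  ring

/-- **`|S| ≤ |ϖ^ℓ|` ON `L × L` AT LEVEL `ℓ`**: if `diag D` is integral on `L × L` and `X·L ⊆ ϖ^ℓ·L` then `|S(w, w′)| ≤ |ϖ^ℓ|` for `w, w′ ∈ L` (`S(w, w′) = ϖ^ℓ·⟨w, ϖ^{−ℓ}Xw′⟩_D`).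
[cite: Kottwitz1986BaseChangeUnits, §1 pp. 240–241] [cite: Jacobowitz1962, §4] -/
theorem v_cross_le_of_latticeInLevel_of_integral {σ : K →+* K} {ϖ : K} (hϖ0 : ϖ ≠ 0) {D : Fin 3 → K} {α β : K} {L : Submodule 𝒪[K] (Fin 3 → K)}
    (hint : ∀ w ∈ L, ∀ w' ∈ L, Valued.v (pairing σ (Matrix.diagonal D) w w') ≤ 1) {ℓ : ℕ}
    (hlev : LatticeInLevel ϖ ℓ (Matrix.diagonal ![α - 1, β - 1, 0]) L) {w w' : Fin 3 → K} (hw : w ∈ L) (hw' : w' ∈ L) :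
    Valued.v (D 0 * σ (w 0) * ((α - 1) * w' 0) + D 1 * σ (w 1) * ((β - 1) * w' 1)) ≤ Valued.v (ϖ ^ ℓ) := by
  have hϖℓ : (ϖ ^ ℓ : K) ≠ 0 := pow_ne_zero _ hϖ0
  have hz := (latticeInLevel_iff_forall_smul_mulVec_mem hϖ0 ℓ _ L).1 hlev w' hw'
  have hp := hint w hw _ hz
  rw [pairing_diagonal_three, smul_diagonal_mulVec_apply, smul_diagonal_mulVec_apply, smul_diagonal_mulVec_apply] at hp
  simp only [Matrix.cons_val_zero, Matrix.cons_val_one, Matrix.cons_val_two, Matrix.tail_cons, Matrix.head_cons, zero_mul, mul_zero, add_zero] at hp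
  have key : D 0 * σ (w 0) * ((α - 1) * w' 0) + D 1 * σ (w 1) * ((β - 1) * w' 1) =
      ϖ ^ ℓ * (σ (w 0) * D 0 * ((ϖ ^ ℓ)⁻¹ * ((α - 1) * w' 0)) + σ (w 1) * D 1 * ((ϖ ^ ℓ)⁻¹ * ((β - 1) * w' 1))) := by
    field_simp
  rw [key, map_mul]
  calc Valued.v (ϖ ^ ℓ) * Valued.v (σ (w 0) * D 0 * ((ϖ ^ ℓ)⁻¹ * ((α - 1) * w' 0)) + σ (w 1) * D 1 * ((ϖ ^ ℓ)⁻¹ * ((β - 1) * w' 1)))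
      ≤ Valued.v (ϖ ^ ℓ) * 1 := mul_le_mul_right hp _
    _ = Valued.v (ϖ ^ ℓ) := mul_one _

/-- **DISCRETENESS**: `|ϖ^{ℓ+1}| < |a| ≤ |ϖ^ℓ|` forces `|a| = |ϖ^ℓ|` (`|ϖ| = exp(−1)`). [cite: Serre1979, Ch. II §3] -/
theorem eq_of_le_of_gt_succ {ϖ : K} (hϖ : Valued.v ϖ = exp (-1 : ℤ)) {ℓ : ℕ} {a : K} (hle : Valued.v a ≤ Valued.v (ϖ ^ ℓ))
    (hgt : Valued.v (ϖ ^ (ℓ + 1)) < Valued.v a) : Valued.v a = Valued.v (ϖ ^ ℓ) := by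
  have ha0 : Valued.v a ≠ 0 := fun h => by rw [h] at hgt; exact (not_lt.2 zero_le) hgt
  rw [← exp_log ha0] at hle hgt ⊢
  rw [v_pow_eq_exp_neg hϖ] at hle hgt ⊢
  rw [exp_le_exp] at hle
  rw [exp_lt_exp] at hgt
  rw [exp_inj]
  push_cast at hgt
  omega

/-- **SELF-DUAL AND NOT AT LEVEL `ℓ + 1` ⇒ A GRAM ENTRY ABOVE `|ϖ^{ℓ+1}|`.**  If `L = V·𝒪³` is its own `diag D`-dual and `X·L ⊄ ϖ^{ℓ+1}·L`, then one of the four S-Gram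
entries `A, B, B′, C` of the HNF basis has valuation `> |ϖ^{ℓ+1}|` — since `S(w, w′) = ⟨w, Xw′⟩_D` is an `𝒪`-combination of them for `w, w′ ∈ L`.
[cite: Kottwitz1986BaseChangeUnits, §1 pp. 240–241] [cite: Jacobowitz1962, §4, §7] -/
theorem exists_gram_gt_of_not_latticeInLevel {σ : K →+* K} (hvσ : ∀ a, Valued.v (σ a) = Valued.v a) {ϖ : K} (hϖ0 : ϖ ≠ 0) {D : Fin 3 → K}
    {α β x y z pb pc : K}
    (hdual : dualLatt σ (Matrix.diagonal D) (latt (Matrix.of ![![1, 0, 0], ![x, pb, 0], ![y, z, pc]])) = latt (Matrix.of ![![1, 0, 0], ![x, pb, 0], ![y, z, pc]]))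
    {ℓ : ℕ} (hnot : ¬ LatticeInLevel ϖ (ℓ + 1) (Matrix.diagonal ![α - 1, β - 1, 0]) (latt (Matrix.of ![![1, 0, 0], ![x, pb, 0], ![y, z, pc]]))) :
    Valued.v (ϖ ^ (ℓ + 1)) < Valued.v (D 0 * (α - 1) + D 1 * σ x * ((β - 1) * x)) ∨ Valued.v (ϖ ^ (ℓ + 1)) < Valued.v (D 1 * σ x * ((β - 1) * pb)) ∨
      Valued.v (ϖ ^ (ℓ + 1)) < Valued.v (D 1 * σ pb * ((β - 1) * x)) ∨ Valued.v (ϖ ^ (ℓ + 1)) < Valued.v (D 1 * σ pb * ((β - 1) * pb)) := by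
  by_contra h
  simp only [not_or, not_lt] at h
  obtain ⟨hA, hB, hB', hC⟩ := h
  have hϖℓ : (ϖ ^ (ℓ + 1) : K) ≠ 0 := pow_ne_zero _ hϖ0
  have hvϖℓ : Valued.v (ϖ ^ (ℓ + 1)) ≠ 0 := (Valuation.ne_zero_iff _).2 hϖℓ
  apply hnot
  rw [latticeInLevel_iff_forall_smul_mulVec_mem hϖ0]
  intro w' hw'
  rw [← hdual, mem_dualLatt]
  intro w hw
  obtain ⟨p, hp, rfl⟩ := Submodule.mem_map.1 hw
  obtain ⟨q, hq, rfl⟩ := Submodule.mem_map.1 hw'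
  rw [LinearMap.restrictScalars_apply, Matrix.toLin'_apply, LinearMap.restrictScalars_apply, Matrix.toLin'_apply]
  rw [pairing_diagonal_three, smul_diagonal_mulVec_apply, smul_diagonal_mulVec_apply, smul_diagonal_mulVec_apply]
  simp only [Matrix.cons_val_zero, Matrix.cons_val_one, Matrix.cons_val_two, Matrix.tail_cons, Matrix.head_cons, zero_mul, mul_zero, add_zero]
  have key : σ (((Matrix.of ![![1, 0, 0], ![x, pb, 0], ![y, z, pc]]) *ᵥ p) 0) * D 0 * ((ϖ ^ (ℓ + 1))⁻¹ * ((α - 1) * ((Matrix.of ![![1, 0, 0], ![x, pb, 0], ![y, z, pc]]) *ᵥ q) 0)) +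
        σ (((Matrix.of ![![1, 0, 0], ![x, pb, 0], ![y, z, pc]]) *ᵥ p) 1) * D 1 * ((ϖ ^ (ℓ + 1))⁻¹ * ((β - 1) * ((Matrix.of ![![1, 0, 0], ![x, pb, 0], ![y, z, pc]]) *ᵥ q) 1)) =
      (ϖ ^ (ℓ + 1))⁻¹ * (σ (p 0) * q 0 * (D 0 * (α - 1) + D 1 * σ x * ((β - 1) * x)) + σ (p 0) * q 1 * (D 1 * σ x * ((β - 1) * pb)) +
        σ (p 1) * q 0 * (D 1 * σ pb * ((β - 1) * x)) + σ (p 1) * q 1 * (D 1 * σ pb * ((β - 1) * pb))) := by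
    rw [← cross_latt_hnf_expand σ D α β x y z pb pc p q]
    ring
  rw [key, map_mul, map_inv₀]
  have hp' := mem_stdLattice.1 hp
  have hq' := mem_stdLattice.1 hq
  -- each of the four terms is bounded by `|ϖ^{ℓ+1}|`
  have hterm : ∀ (i j : Fin 3) (g : K), Valued.v g ≤ Valued.v (ϖ ^ (ℓ + 1)) → Valued.v (σ (p i) * q j * g) ≤ Valued.v (ϖ ^ (ℓ + 1)) := fun i j g hg => by
    rw [map_mul, map_mul, hvσ]
    calc Valued.v (p i) * Valued.v (q j) * Valued.v g ≤ 1 * 1 * Valued.v (ϖ ^ (ℓ + 1)) := mul_le_mul' (mul_le_mul' (hp' i) (hq' j)) hg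
      _ = Valued.v (ϖ ^ (ℓ + 1)) := by rw [one_mul, one_mul]
  have hsum : Valued.v (σ (p 0) * q 0 * (D 0 * (α - 1) + D 1 * σ x * ((β - 1) * x)) + σ (p 0) * q 1 * (D 1 * σ x * ((β - 1) * pb)) +
      σ (p 1) * q 0 * (D 1 * σ pb * ((β - 1) * x)) + σ (p 1) * q 1 * (D 1 * σ pb * ((β - 1) * pb))) ≤ Valued.v (ϖ ^ (ℓ + 1)) :=
    (Valuation.map_add _ _ _).trans (max_le ((Valuation.map_add _ _ _).trans (max_le ((Valuation.map_add _ _ _).trans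
      (max_le (hterm 0 0 _ hA) (hterm 0 1 _ hB))) (hterm 1 0 _ hB'))) (hterm 1 1 _ hC))
  calc (Valued.v (ϖ ^ (ℓ + 1)))⁻¹ * Valued.v (σ (p 0) * q 0 * (D 0 * (α - 1) + D 1 * σ x * ((β - 1) * x)) + σ (p 0) * q 1 * (D 1 * σ x * ((β - 1) * pb)) +
          σ (p 1) * q 0 * (D 1 * σ pb * ((β - 1) * x)) + σ (p 1) * q 1 * (D 1 * σ pb * ((β - 1) * pb)))
      ≤ (Valued.v (ϖ ^ (ℓ + 1)))⁻¹ * Valued.v (ϖ ^ (ℓ + 1)) := mul_le_mul_right hsum _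
    _ = 1 := inv_mul_cancel₀ hvϖℓ

/-! ## §2  The two Gram–Schmidt triples on the HNF basis -/

omit [Valued K ℤᵐ⁰] in
/-- Coordinates of `V·(a, b′, c′)` for the HNF model. [cite: Serre1980Trees, Ch. II §1.1] -/
theorem mulVec_hnf_apply (x y z p r a b' c' : K) :
    ((Matrix.of ![![1, 0, 0], ![x, p, 0], ![y, z, r]]) *ᵥ ![a, b', c']) 0 = a ∧
      ((Matrix.of ![![1, 0, 0], ![x, p, 0], ![y, z, r]]) *ᵥ ![a, b', c']) 1 = x * a + p * b' ∧
        ((Matrix.of ![![1, 0, 0], ![x, p, 0], ![y, z, r]]) *ᵥ ![a, b', c']) 2 = y * a + z * b' + r * c' := by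
  rw [mulVec_hnf]
  simp

/-- `V·u ∈ V·𝒪³` for integral `u`. [cite: Serre1980Trees, Ch. II §1.1] -/
theorem mulVec_three_mem_latt (V : Matrix (Fin 3) (Fin 3) K) {a b' c' : K} (ha : Valued.v a ≤ 1) (hb : Valued.v b' ≤ 1) (hc : Valued.v c' ≤ 1) :
    V *ᵥ ![a, b', c'] ∈ latt V :=
  mulVec_mem_latt _ (mem_stdLattice.2 fun i => by fin_cases i <;> assumption)

/-- **GENERATION BY A UNITRIANGULAR CHANGE OF THE HNF BASIS.**  For `κ ∈ 𝒪`, every `w ∈ V·𝒪³` is `a·V(1,0,0) + b′·V(−κ,1,0) + c′·V(0,0,1)` with `a, b′ ∈ 𝒪`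
(`V q = (q₀ + q₁κ)·Ve₀ + q₁·V(−κ,1,0) + q₂·Ve₂`). [cite: Serre1980Trees, Ch. II §1.1] -/
theorem exists_coords_shear₀ (V : Matrix (Fin 3) (Fin 3) K) {κ : K} (hκ : Valued.v κ ≤ 1) {w : Fin 3 → K} (hw : w ∈ latt V) :
    ∃ a b' c' : K, Valued.v a ≤ 1 ∧ Valued.v b' ≤ 1 ∧ ∀ i, w i = a * (V *ᵥ ![1, 0, 0]) i + b' * (V *ᵥ ![-κ, 1, 0]) i + c' * (V *ᵥ ![0, 0, 1]) i := by
  obtain ⟨q, hq, rfl⟩ := Submodule.mem_map.1 hw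
  have hq' := mem_stdLattice.1 hq
  refine ⟨q 0 + q 1 * κ, q 1, q 2, (Valuation.map_add _ _ _).trans (max_le (hq' 0) (by rw [map_mul]; exact mul_le_one' (hq' 1) hκ)), hq' 1, fun i => ?_⟩
  have hq3 : q = (q 0 + q 1 * κ) • ![1, 0, 0] + q 1 • ![-κ, 1, 0] + q 2 • ![0, 0, 1] := by
    ext j; fin_cases j <;> simp
  rw [LinearMap.restrictScalars_apply, Matrix.toLin'_apply]
  conv_lhs => rw [hq3]
  simp only [Matrix.mulVec_add, Matrix.mulVec_smul, Pi.add_apply, Pi.smul_apply, smul_eq_mul]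

/-- The same with the roles of the first two basis vectors exchanged: `V q = (q₁ + q₀κ)·V(0,1,0) + q₀·V(1,−κ,0) + q₂·Ve₂`. [cite: Serre1980Trees, Ch. II §1.1] -/
theorem exists_coords_shear₁ (V : Matrix (Fin 3) (Fin 3) K) {κ : K} (hκ : Valued.v κ ≤ 1) {w : Fin 3 → K} (hw : w ∈ latt V) :
    ∃ a b' c' : K, Valued.v a ≤ 1 ∧ Valued.v b' ≤ 1 ∧ ∀ i, w i = a * (V *ᵥ ![0, 1, 0]) i + b' * (V *ᵥ ![1, -κ, 0]) i + c' * (V *ᵥ ![0, 0, 1]) i := by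
  obtain ⟨q, hq, rfl⟩ := Submodule.mem_map.1 hw
  have hq' := mem_stdLattice.1 hq
  refine ⟨q 1 + q 0 * κ, q 0, q 2, (Valuation.map_add _ _ _).trans (max_le (hq' 1) (by rw [map_mul]; exact mul_le_one' (hq' 0) hκ)), hq' 0, fun i => ?_⟩
  have hq3 : q = (q 1 + q 0 * κ) • ![0, 1, 0] + q 0 • ![1, -κ, 0] + q 2 • ![0, 0, 1] := by
    ext j; fin_cases j <;> simp
  rw [LinearMap.restrictScalars_apply, Matrix.toLin'_apply]
  conv_lhs => rw [hq3]
  simp only [Matrix.mulVec_add, Matrix.mulVec_smul, Pi.add_apply, Pi.smul_apply, smul_eq_mul]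

omit [Valued K ℤᵐ⁰] in
/-- **TRIPLE A — THE TWO VALUES.**  With `κ·A = B` (`A = S(v⁰,v⁰) ≠ 0`, `B = S(v⁰,v¹)`): for `y₁ = Ve₀ = v⁰` and `y₂ = V(−κ,1,0) = v¹ − κv⁰` one has `S(y₁, y₂) = 0` and
`S(y₂, y₂) = D₀D₁(α−1)(β−1)σ(p)p ∕ A` (`AC − BB′ = D₀D₁(α−1)(β−1)N(p)`; the two `σκ`-terms cancel). [cite: Jacobowitz1962, §4, §7] -/
theorem triple_A_values (σ : K →+* K) (D : Fin 3 → K) (α β x y z p r : K) {κ : K} (hA0 : D 0 * (α - 1) + D 1 * σ x * ((β - 1) * x) ≠ 0)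
    (hκA : κ * (D 0 * (α - 1) + D 1 * σ x * ((β - 1) * x)) = D 1 * σ x * ((β - 1) * p)) :
    D 0 * σ (((Matrix.of ![![1, 0, 0], ![x, p, 0], ![y, z, r]]) *ᵥ ![1, 0, 0]) 0) * ((α - 1) * ((Matrix.of ![![1, 0, 0], ![x, p, 0], ![y, z, r]]) *ᵥ ![-κ, 1, 0]) 0) +
        D 1 * σ (((Matrix.of ![![1, 0, 0], ![x, p, 0], ![y, z, r]]) *ᵥ ![1, 0, 0]) 1) * ((β - 1) * ((Matrix.of ![![1, 0, 0], ![x, p, 0], ![y, z, r]]) *ᵥ ![-κ, 1, 0]) 1) = 0 ∧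
      D 0 * σ (((Matrix.of ![![1, 0, 0], ![x, p, 0], ![y, z, r]]) *ᵥ ![-κ, 1, 0]) 0) * ((α - 1) * ((Matrix.of ![![1, 0, 0], ![x, p, 0], ![y, z, r]]) *ᵥ ![-κ, 1, 0]) 0) +
          D 1 * σ (((Matrix.of ![![1, 0, 0], ![x, p, 0], ![y, z, r]]) *ᵥ ![-κ, 1, 0]) 1) * ((β - 1) * ((Matrix.of ![![1, 0, 0], ![x, p, 0], ![y, z, r]]) *ᵥ ![-κ, 1, 0]) 1) =
        D 0 * D 1 * (α - 1) * (β - 1) * (σ p * p) / (D 0 * (α - 1) + D 1 * σ x * ((β - 1) * x)) := by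
  obtain ⟨h00, h01, -⟩ := mulVec_hnf_apply x y z p r (1 : K) 0 0
  obtain ⟨h10, h11, -⟩ := mulVec_hnf_apply x y z p r (-κ) 1 0
  rw [h00, h01, h10, h11]
  simp only [mul_one, mul_zero, add_zero, map_one, map_add, map_mul, map_neg]
  constructor
  · linear_combination (-1 : K) * hκA
  · rw [eq_div_iff hA0]
    linear_combination (σ κ * (D 0 * (α - 1) + D 1 * σ x * ((β - 1) * x)) - D 1 * σ p * ((β - 1) * x)) * hκA

omit [Valued K ℤᵐ⁰] in
/-- **TRIPLE C — THE TWO VALUES** (`p = 1`, i.e. `b = 0`): for `y₁ = Ve₁ = v¹ = (0, 1, z)` and `y₂ = V(1, −x, 0) = v⁰ − x·v¹ = (1, 0, y − xz)`: `S(y₁, y₂) = 0` and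
`S(y₂, y₂) = D₀(α−1)`. [cite: Jacobowitz1962, §4, §7] -/
theorem triple_C_values (σ : K →+* K) (D : Fin 3 → K) (α β x y z r : K) :
    D 0 * σ (((Matrix.of ![![1, 0, 0], ![x, 1, 0], ![y, z, r]]) *ᵥ ![0, 1, 0]) 0) * ((α - 1) * ((Matrix.of ![![1, 0, 0], ![x, 1, 0], ![y, z, r]]) *ᵥ ![1, -x, 0]) 0) +
        D 1 * σ (((Matrix.of ![![1, 0, 0], ![x, 1, 0], ![y, z, r]]) *ᵥ ![0, 1, 0]) 1) * ((β - 1) * ((Matrix.of ![![1, 0, 0], ![x, 1, 0], ![y, z, r]]) *ᵥ ![1, -x, 0]) 1) = 0 ∧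
      D 0 * σ (((Matrix.of ![![1, 0, 0], ![x, 1, 0], ![y, z, r]]) *ᵥ ![1, -x, 0]) 0) * ((α - 1) * ((Matrix.of ![![1, 0, 0], ![x, 1, 0], ![y, z, r]]) *ᵥ ![1, -x, 0]) 0) +
          D 1 * σ (((Matrix.of ![![1, 0, 0], ![x, 1, 0], ![y, z, r]]) *ᵥ ![1, -x, 0]) 1) * ((β - 1) * ((Matrix.of ![![1, 0, 0], ![x, 1, 0], ![y, z, r]]) *ᵥ ![1, -x, 0]) 1) =
        D 0 * (α - 1) := by
  obtain ⟨h00, h01, -⟩ := mulVec_hnf_apply x y z (1 : K) r 0 1 0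
  obtain ⟨h10, h11, -⟩ := mulVec_hnf_apply x y z (1 : K) r 1 (-x) 0
  rw [h00, h01, h10, h11]
  simp only [mul_one, mul_zero, add_zero, zero_add, map_zero, map_one, one_mul, mul_neg, add_neg_cancel, zero_mul]
  exact ⟨trivial, trivial⟩


end Summit.HodgeConjecture.HodgeConjecture.Cruxes.H413.F0P3cDyRamHNFCrossGram

end
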